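import Literature.Computability.AlgebraicComplexity.DeterminantalConormalBound
import Literature.Computability.AlgebraicComplexity.VonZurGathenRegularity
import Literature.Computability.AlgebraicComplexity.RankOneDeterminantalExpressionsProofs
import Mathlib.Analysis.Complex.Exponential
import Mathlib.Data.Nat.Choose.Vandermonde
import Mathlib.Data.Nat.Choose.Bounds
import Mathlib.RingTheory.AlgebraicIndependent.TranscendenceBasis
import Mathlib.Algebra.MvPolynomial.Monad
import Mathlib.LinearAlgebra.Matrix.SchurComplement
import Mathlib.Data.Matrix.ColumnRowPartitioned
import HarnessLib

/-!
# Sheshadri's determinantal conormal bound — the elementary front end of the printed proof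
# (arXiv:2606.13628, Lemma 2 and §3.1 Step 2: the kernel lift)

This file accompanies `DeterminantalConormalBound.lean`. Its named fact
`Sheshadri2026_polarCount_le` (K. Sheshadri, arXiv:2606.13628, Thm. 3 (i), in polar-count form) is
NOT discharged here: the printed proof of Thm. 3 (i) rests on two intersection-theoretic inputs
that neither Mathlib nor `Literature` provides — Lemma 4 there (Kleiman transversality of a
generic flag in a product of projective spaces, characteristic `0`) and Lemma 5 there (the Bézout
bound `Σ_{p isolated in Z(s)} dim_ℂ O_{Z(s),p} ≤ ∫_P c_D(E)` for a section `s` of a direct sum `E`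
of globally generated line bundles on `P = Π ℙ^{a_l}`, Fulton, *Intersection Theory*, Ch. 12 and
14) — together with conormal cycles and their multidegrees (§2.1, Lemma 1, Prop. 2 there).

What IS elementary, and is proved below following the paper, is the algebra of Lemma 2 and of
§3.1 Steps 2, 3 and 5 (Step 3 — the generic `Λ`-reduction — and Step 5 — the local normal form —
are the last two sections of the file). First §3.1 Step 2 ("the kernel lift"), which turns a
polar point of `f = det A` into a solution of the kernel incidence system of §3.1 Step 4 (the square multihomogeneous system on
`ℙⁿ × ℙ^{m−1} × ℙ^{m−1}` whose Bézout number is `B(m, n)`):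

* `derivation_det_eq_trace_adjugate_mul` — Jacobi's formula `D(det M) = tr(adj M · D M)` for a
  derivation `D` (eq. (2.1) of the paper), from the row expansion `VonZurGathen.derivation_det`;
* `eval_pderiv_det` — its evaluated form `∂ᵢ(det A)(x) = tr(adj A(x) · Aᵢ(x))` with
  `A(x) = A.map (eval x)` and `Aᵢ(x) = A.map (eval x ∘ ∂ᵢ)`;
* `exists_kernelPair_of_adjugate_ne_zero`, `rank_eq_of_det_eq_zero_of_adjugate_ne_zero` — over a
  field, `det M = 0` and `adj M ≠ 0` force `adj M = v uᵀ` with `u ≠ 0` a left kernel vector and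
  `v ≠ 0` a right kernel vector of `M`, and `rank M = k − 1` (Lemma 2, proof of (b) ⇔ (c);
  §3.1 Step 2, eq. (3.3): "`adj Â(x*) = α v* (u*)ᵀ, α ≠ 0`", the scalar absorbed into `u`);
* `exists_kernelPair_of_eval_pderiv_ne_zero` — hence at a point `x` with `det A(x) = 0` and
  `∇(det A)(x) ≠ 0` one has `∂ᵢ(det A)(x) = uᵀ Aᵢ(x) v` for such a kernel pair (Step 2: "each
  count point lifts to the unique point `(x*, [u*], [v*]) ∈ ℙⁿ × ℙ^{m−1} × ℙ^{m−1}`");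
* `polarSet_subset_kernelIncidence` — consequently the polar set `T_f(a, b, c)` (`polarSet`) of
  `f = det A` is contained (via `x ↦ x`) in the set of `x` carrying a solution `(x, u, v)` of the
  kernel incidence system `uᵀ A(x) = 0`, `A(x) v = 0`, `(uᵀ Aᵢ(x) v)ᵢ ∈ (ℂ a + ℂ b) ∖ {0}`,
  `c · x = 1`;
* `pderiv_eq_C_coeff_of_totalDegree_le_one`, `polarSet_subset_kernelIncidence_of_isAffineDetRepr`
  — for an AFFINE representation (`IsAffineDetRepr f A`, `A = A₀ + Σ xᵢ Aᵢ`) the matrices `Aᵢ(x)`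
  are the constant coefficient matrices `Aᵢ = (coeff_{xᵢ} A_{rc})_{rc}`, which is the form of the
  system printed in §3.1 Step 4.

Independently of the geometry, the file also proves the arithmetic of the bound `B(m, N)`
(`conormalBezout`) that the routes consume: the reindexed closed form
`conormalBezout_eq_sum_range` (`B(m,N) = Σ_{j=0}^{N−2} C(m,j+1) C(m−1,N−2−j) C(N−2,j)`, the
spelling of route `ValiantsHypothesis/PermanentClass`) and the two estimates of Lemma 18 of the
paper, `conormalBezout_le_two_pow_mul_choose` (`B(m,N) ≤ 2^{N−2} C(2m−1,N−1)`, Vandermonde) and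
`conormalBezout_le_pow` (`B(m,N) ≤ (4em/(N−1))^{N−1}` for `N ≥ 2`). The last section identifies
`conormalBezout m N` with the paper's generating-function DEFINITION of `B(m, N)`
(`coeff_generatingFunction_eq_conormalBezout`, §3.1 Step 6).

Finally, the file proves the named fact IN ITS DEGENERATE RANGE `2m < N` (where `B(m, N) = 0`):
`Sheshadri2026_polarCount_le_of_two_mul_lt` — for `f = det A`, `A` affine of size `m` in
`N > 2m` variables, the generic polar set is EMPTY
(`DeterminantalConormal.exists_generic_polarSet_eq_empty_of_two_mul_lt`), the elementary avatar of
"small determinantal complexity ⇒ degenerate dual variety" (Landsberg–Manivel–Ressayre 2013,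
§1.2, Thm. 1.2.1). Mechanism: by the kernel lift the Gauss image of `V(f)` lies in the linear
image of the rank-one matrices; genericity of the pencil is made effective by a transcendence
degree count (`DeterminantalConormal.exists_ne_zero_eval_comp_eq_zero`: `|κ| > |ι|` polynomials
in the variables `ι` are algebraically dependent, so the image of `K^ι → K^κ` lies on a
hypersurface). The complementary range `N ≤ 2m` is Thm. 3 (i) proper and is not formalised.

The local algebra of §3.1 Step 5 (ii)–(iii) (the normal form of the kernel incidence near a
lift, in the charts `u_m = v_m = 1`, for the bordered matrix `Â = [[B, c], [r, s]]` with `B`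
invertible and the right block reduced by `Λ = [Λ_top | λ]`) is proved as matrix identities over
a commutative ring: `DeterminantalConormal.det_border_eq` (Schur: `det Â = det B · g`),
`…sumElim_vecMul_border_eq_zero_iff` (left block `⇔ u' = −rB⁻¹ ∧ g = 0`),
`…fromCols_mulVec_border_mulVec_sumElim` (the exact identity `ΛÂv = M_v z + gλ`),
`…kernelBlock_chart_iff` (for `M_v` invertible the bilinear block is the graph `u' = −rB⁻¹`,
`v' = −B⁻¹c` over `{g = 0}`), `…adjugate_border_eq` (conormal identity `adj Â = det B · v uᵀ` on
`{g = 0}`) and `…trace_adjugate_border_mul` (`tr(adj Â · N) = det B · uᵀ N v`). What is NOT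
formalised of Step 5 is its scheme-theoretic conclusion ("a reduced isolated point of the
solution scheme"), which needs Step 1 (Lemma 4) and is only consumed by Lemma 5.

No new definitions and no new named facts are introduced (D-0026); everything here is a theorem.

## References

* K. Sheshadri, *A near-quadratic lower bound on the border determinantal complexity of
  `Σᵢ xᵢⁿ` via conormal specialization*, arXiv:2606.13628 (2026): Lemma 2 and eq. (2.1) (p. 5),
  §3.1 Steps 2, 4, 5 (ii)–(iii) and 6 (pp. 7–9), Lemma 18 (p. 18). [Sheshadri2026Border] — unrefereed claim; only its elementary
  linear algebra is formalised in this file.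
* J. von zur Gathen, *Permanent and determinant*, Linear Algebra Appl. 96 (1987), proof of
  Thm. 3.1 (the same chain rule; `VonZurGathenRegularity.lean`). [Vonzurgathen1987]
* J. M. Landsberg, L. Manivel, N. Ressayre, *Hypersurfaces with degenerate duals and the geometric
  complexity theory program*, Comment. Math. Helv. 88 (2013) 469–484, §1.2 and Thm. 1.2.1
  (`dc̄(P) ≥ (dim Z(P)^* + 1)/2`). [LandsbergManivelRessayre2013]
-/

noncomputable section

open MvPolynomial Matrix

namespace Literature.Computability.AlgebraicComplexity

namespace DeterminantalConormal

/-! ### Jacobi's formula (eq. (2.1) of the paper) -/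

section Jacobi

variable {R S : Type*} [CommRing R] [CommRing S] [Algebra R S] {n : Type*} [Fintype n]
  [DecidableEq n]

/-- **Jacobi's formula** for a derivation `D`: `D (det M) = tr (adj M · D M)`, `D M` taken
entrywise (row expansion `VonZurGathen.derivation_det` plus the cofactor expansion
`VonZurGathen.det_updateRow_eq_sum_mul_adjugate`). This is eq. (2.1) of the paper,
`∂_w F(x) = tr(adj Â(x) · Â(w))`, before evaluation. [cite: Sheshadri2026Border, eq. (2.1)] -/
theorem derivation_det_eq_trace_adjugate_mul (D : Derivation R S S) (M : Matrix n n S) :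
    D M.det = (M.adjugate * M.map D).trace := by
  rw [VonZurGathen.derivation_det, Matrix.trace]
  simp_rw [VonZurGathen.det_updateRow_eq_sum_mul_adjugate]
  rw [Finset.sum_comm]
  refine Finset.sum_congr rfl fun c _ => ?_
  rw [Matrix.diag_apply, Matrix.mul_apply]
  refine Finset.sum_congr rfl fun r _ => ?_
  rw [Matrix.map_apply, mul_comm]

end Jacobi

/-! ### Jacobi's formula evaluated at a point -/

section Eval

variable {K : Type*} [CommRing K] {σ : Type*} {n : Type*} [Fintype n] [DecidableEq n]

/-- **Jacobi's formula at a point**: for a square matrix `A` of polynomials and a point `x`,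
`∂ᵢ(det A)(x) = tr(adj A(x) · Aᵢ(x))`, where `A(x) = A.map (eval x)` and
`Aᵢ(x) = (∂ᵢ A_{rc}(x))_{rc}`; eq. (2.1) of the paper evaluated at `x` in the coordinate direction
`w = eᵢ`. [cite: Sheshadri2026Border, eq. (2.1)] -/
theorem eval_pderiv_det (A : Matrix n n (MvPolynomial σ K)) (i : σ) (x : σ → K) :
    eval x (pderiv i A.det) =
      ((A.map (eval x)).adjugate * A.map (fun p => eval x (pderiv i p))).trace := by
  rw [derivation_det_eq_trace_adjugate_mul, AddMonoidHom.map_trace (eval x), Matrix.map_mul,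
    ← RingHom.mapMatrix_apply (eval x) A.adjugate, RingHom.map_adjugate, RingHom.mapMatrix_apply,
    Matrix.map_map]
  rfl

/-- `det (A(x)) = (det A)(x)`. [folklore] -/
theorem det_map_eval (A : Matrix n n (MvPolynomial σ K)) (x : σ → K) :
    (A.map (eval x)).det = eval x A.det := by
  rw [← RingHom.mapMatrix_apply, ← RingHom.map_det]

end Eval

/-! ### Affine entries: the derivative matrices are the constant coefficient matrices -/

section Affine

variable {R : Type*} [CommSemiring R] {σ : Type*}

/-- A polynomial of total degree `≤ 1` (an affine-linear form `p = p₀ + Σ pᵢ xᵢ`) has constant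
partial derivatives: `∂ᵢ p = C pᵢ` with `pᵢ = coeff_{xᵢ} p`. [folklore] -/
theorem pderiv_eq_C_coeff_of_totalDegree_le_one {p : MvPolynomial σ R} (hp : p.totalDegree ≤ 1)
    (i : σ) : pderiv i p = C (p.coeff (Finsupp.single i 1)) := by
  classical
  ext m
  rw [coeff_pderiv, coeff_C]
  split_ifs with hm
  · subst hm
    simp
  · rw [coeff_eq_zero_of_totalDegree_lt, zero_mul]
    rw [← Finsupp.degree_apply, map_add, Finsupp.degree_single]
    have h0 : Finsupp.degree m ≠ 0 := fun h => hm ((Finsupp.degree_eq_zero_iff m).mp h).symm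
    omega

/-- Hence `(∂ᵢ p)(x) = coeff_{xᵢ} p` for an affine-linear `p`, independently of `x`. [folklore] -/
theorem eval_pderiv_eq_coeff_of_totalDegree_le_one {p : MvPolynomial σ R}
    (hp : p.totalDegree ≤ 1) (i : σ) (x : σ → R) :
    eval x (pderiv i p) = p.coeff (Finsupp.single i 1) := by
  rw [pderiv_eq_C_coeff_of_totalDegree_le_one hp, eval_C]

/-- For an affine determinantal representation `A = A₀ + Σᵢ xᵢ Aᵢ` (`IsAffineDetRepr f A`) the
derivative matrix `Aᵢ(x) = (∂ᵢ A_{rc}(x))_{rc}` is the constant coefficient matrix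
`Aᵢ = (coeff_{xᵢ} A_{rc})_{rc}` (the `Âᵢ` of §3.1 Step 2 of the paper). [cite: Sheshadri2026Border, §3.1 Step 2] -/
theorem map_eval_pderiv_eq_of_isAffineDetRepr {S : Type*} [CommRing S] {f : MvPolynomial σ S}
    {k : ℕ} {A : Matrix (Fin k) (Fin k) (MvPolynomial σ S)} (hA : IsAffineDetRepr f A) (i : σ)
    (x : σ → S) :
    A.map (fun p => eval x (pderiv i p)) = A.map (fun p => p.coeff (Finsupp.single i 1)) := by
  obtain ⟨hdeg, -⟩ := hA
  ext r c
  exact eval_pderiv_eq_coeff_of_totalDegree_le_one (hdeg r c) i x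

end Affine

/-! ### Lemma 2 / §3.1 Step 2: corank one and the kernel pair -/

section KernelPair

variable {K : Type*} [Field K] {k : ℕ}

/-- **The kernel pair** (Lemma 2, proof of (b) ⇔ (c); §3.1 Step 2, eq. (3.3)): over a field, if
`det M = 0` and `adj M ≠ 0` then `adj M = v uᵀ` (`vecMulVec v u`) with `u ≠ 0`, `v ≠ 0`,
`uᵀ M = 0` and `M v = 0` — "its columns lie in `ker M` and its rows in the left kernel (from
`M · adj M = adj M · M = det M · I = 0`), so `adj M = α v uᵀ` with `α ≠ 0`" (the scalar is
absorbed into `u` here). Uses `VonZurGathen.adjugate_eq_zero_of_rank_lt` (`adj M ≠ 0 ⇒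
rank M ≥ k − 1`), rank–nullity, and `exists_vecMulVec_of_rank_le_one`. [cite: Sheshadri2026Border, Lemma 2] -/
theorem exists_kernelPair_of_adjugate_ne_zero {M : Matrix (Fin k) (Fin k) K} (hdet : M.det = 0)
    (hadj : M.adjugate ≠ 0) :
    ∃ u v : Fin k → K, u ≠ 0 ∧ v ≠ 0 ∧ u ᵥ* M = 0 ∧ M *ᵥ v = 0 ∧ M.adjugate = vecMulVec v u := by
  have hrk : k ≤ M.rank + 1 := by
    by_contra h
    exact hadj (VonZurGathen.adjugate_eq_zero_of_rank_lt (by omega))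
  have hrange : LinearMap.range M.adjugate.mulVecLin ≤ LinearMap.ker M.mulVecLin := by
    rintro _ ⟨w, rfl⟩
    rw [LinearMap.mem_ker, Matrix.mulVecLin_apply, Matrix.mulVecLin_apply, Matrix.mulVec_mulVec,
      Matrix.mul_adjugate, hdet, zero_smul, Matrix.zero_mulVec]
  have hker : Module.finrank K (LinearMap.ker M.mulVecLin) + M.rank = k := by
    have h := LinearMap.finrank_range_add_finrank_ker M.mulVecLin
    rw [Module.finrank_fintype_fun_eq_card, Fintype.card_fin] at h
    unfold Matrix.rank
    omega
  have hadjrank : M.adjugate.rank ≤ 1 := by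
    unfold Matrix.rank
    calc Module.finrank K (LinearMap.range M.adjugate.mulVecLin)
        ≤ Module.finrank K (LinearMap.ker M.mulVecLin) := Submodule.finrank_mono hrange
      _ ≤ 1 := by omega
  obtain ⟨v, u, hvu⟩ := exists_vecMulVec_of_rank_le_one _ hadjrank
  have hv : v ≠ 0 := by
    rintro rfl
    exact hadj (by rw [hvu, zero_vecMulVec])
  have hu : u ≠ 0 := by
    rintro rfl
    exact hadj (by rw [hvu, vecMulVec_zero])
  refine ⟨u, v, hu, hv, ?_, ?_, hvu⟩
  · have h1 : vecMulVec v (u ᵥ* M) = 0 := by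
      rw [← vecMulVec_mul, ← hvu, Matrix.adjugate_mul, hdet, zero_smul]
    rcases vecMulVec_eq_zero.mp h1 with h | h
    · exact absurd h hv
    · exact h
  · have h1 : vecMulVec (M *ᵥ v) u = 0 := by
      rw [← mul_vecMulVec, ← hvu, Matrix.mul_adjugate, hdet, zero_smul]
    rcases vecMulVec_eq_zero.mp h1 with h | h
    · exact h
    · exact absurd h hu

/-- **Corank exactly one** (Lemma 2 (c); §3.1 Step 2: "`adj Â(x*) ≠ 0`, hence
`rank Â(x*) ≥ m − 1`; since `F(x*) = 0` the rank is exactly `m − 1`"), so that the left and right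
kernels are lines and the lift `(x*, [u*], [v*])` of Step 2 is unique. [cite: Sheshadri2026Border, §3.1 Step 2] -/
theorem rank_eq_of_det_eq_zero_of_adjugate_ne_zero {M : Matrix (Fin k) (Fin k) K}
    (hdet : M.det = 0) (hadj : M.adjugate ≠ 0) : M.rank = k - 1 := by
  have hrk : k ≤ M.rank + 1 := by
    by_contra h
    exact hadj (VonZurGathen.adjugate_eq_zero_of_rank_lt (by omega))
  have hlt : M.rank < k := by
    by_contra h
    have heq : M.rank = k := le_antisymm (Matrix.rank_le_width M) (not_lt.mp h)
    have htop : LinearMap.range M.mulVecLin = ⊤ :=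
      Submodule.eq_top_of_finrank_eq (by
        rw [Module.finrank_fintype_fun_eq_card, Fintype.card_fin]
        exact heq)
    have hsurj : Function.Surjective M.mulVec := fun w => by
      obtain ⟨y, hy⟩ := LinearMap.range_eq_top.mp htop w
      exact ⟨y, hy⟩
    have hU : IsUnit M := Matrix.mulVec_surjective_iff_isUnit.mp hsurj
    exact ((Matrix.isUnit_iff_isUnit_det M).mp hU).ne_zero hdet
  omega

/-- **The kernel lift** (§3.1 Step 2 of the paper): let `A` be a square matrix of polynomials
and `x` a point with `det A(x) = 0` and `∇(det A)(x) ≠ 0`. Then `A(x)` has a left kernel vector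
`u ≠ 0` and a right kernel vector `v ≠ 0` with `adj A(x) = v uᵀ`, and for every coordinate
direction `i`, `∂ᵢ(det A)(x) = uᵀ Aᵢ(x) v` where `Aᵢ(x) = (∂ᵢ A_{rc}(x))_{rc}` — eq. (3.3),
`∂ᵢ F(x*) = α (u*)ᵀ Âᵢ v*`, with `α` absorbed into `u`. (No hypothesis on the degrees of the
entries of `A`.) [cite: Sheshadri2026Border, §3.1 Step 2] -/
theorem exists_kernelPair_of_eval_pderiv_ne_zero {σ : Type*}
    (A : Matrix (Fin k) (Fin k) (MvPolynomial σ K)) {x : σ → K} (hfx : eval x A.det = 0)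
    (hdf : ∃ i, eval x (pderiv i A.det) ≠ 0) :
    ∃ u v : Fin k → K, u ≠ 0 ∧ v ≠ 0 ∧ u ᵥ* A.map (eval x) = 0 ∧ A.map (eval x) *ᵥ v = 0 ∧
      (A.map (eval x)).adjugate = vecMulVec v u ∧
      ∀ i, eval x (pderiv i A.det) = u ⬝ᵥ (A.map (fun p => eval x (pderiv i p)) *ᵥ v) := by
  have hdet : (A.map (eval x)).det = 0 := by rw [det_map_eval, hfx]
  have hadj : (A.map (eval x)).adjugate ≠ 0 := by
    obtain ⟨i, hi⟩ := hdf
    intro h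
    apply hi
    rw [eval_pderiv_det, h, Matrix.zero_mul, Matrix.trace_zero]
  obtain ⟨u, v, hu, hv, huM, hMv, hvu⟩ := exists_kernelPair_of_adjugate_ne_zero hdet hadj
  refine ⟨u, v, hu, hv, huM, hMv, hvu, fun i => ?_⟩
  rw [eval_pderiv_det, hvu, vecMulVec_mul, Matrix.trace_vecMulVec, dotProduct_comm,
    ← Matrix.dotProduct_mulVec]

/-- At such a point the evaluated matrix has rank exactly `k − 1` (uniqueness of the lift up to
scalars). [cite: Sheshadri2026Border, §3.1 Step 2] -/
theorem rank_map_eval_of_eval_pderiv_ne_zero {σ : Type*}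
    (A : Matrix (Fin k) (Fin k) (MvPolynomial σ K)) {x : σ → K} (hfx : eval x A.det = 0)
    (hdf : ∃ i, eval x (pderiv i A.det) ≠ 0) : (A.map (eval x)).rank = k - 1 := by
  refine rank_eq_of_det_eq_zero_of_adjugate_ne_zero (by rw [det_map_eval, hfx]) ?_
  obtain ⟨i, hi⟩ := hdf
  intro h
  apply hi
  rw [eval_pderiv_det, h, Matrix.zero_mul, Matrix.trace_zero]

end KernelPair

/-! ### The polar set injects into the kernel incidence (§3.1 Steps 2 and 4) -/

section PolarSet

variable {σ : Type*} [Fintype σ] {k : ℕ}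

/-- **Polar points are kernel-incidence points** (§3.1 Steps 2 and 4 of the paper, for an
arbitrary square polynomial matrix `A` with `det A = f`): every `x ∈ T_f(a, b, c)` carries a pair
`(u, v)` of non-zero left/right kernel vectors of `A(x)` such that the covector
`(uᵀ Aᵢ(x) v)ᵢ = ∇f(x)` is non-zero and lies on the pencil `ℂ a + ℂ b`, and `c · x = 1`; i.e.
`x ↦ (x, [u], [v])` maps the polar set injectively into the solutions of the kernel incidence
system `uᵀ A(x) = 0`, `A(x) v = 0`, `ℓ_t((uᵀ Aᵢ(x) v)ᵢ) = 0`, `M(x) = 0`. [cite: Sheshadri2026Border, §3.1 Steps 2, 4] -/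
theorem polarSet_subset_kernelIncidence {f : MvPolynomial σ ℂ}
    {A : Matrix (Fin k) (Fin k) (MvPolynomial σ ℂ)} (hA : A.det = f) (a b c : σ → ℂ) :
    polarSet f a b c ⊆ {x | ∃ u v : Fin k → ℂ, u ≠ 0 ∧ v ≠ 0 ∧ u ᵥ* A.map (eval x) = 0 ∧
      A.map (eval x) *ᵥ v = 0 ∧
      (∃ i, u ⬝ᵥ (A.map (fun p => eval x (pderiv i p)) *ᵥ v) ≠ 0) ∧
      (∃ s t : ℂ, ∀ i, u ⬝ᵥ (A.map (fun p => eval x (pderiv i p)) *ᵥ v) = s * a i + t * b i) ∧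
      ∑ i, c i * x i = 1} := by
  intro x hx
  obtain ⟨hfx, hdf, hspan, hchart⟩ := hx
  subst hA
  obtain ⟨u, v, hu, hv, huM, hMv, -, hgrad⟩ :=
    exists_kernelPair_of_eval_pderiv_ne_zero A hfx hdf
  refine ⟨u, v, hu, hv, huM, hMv, ?_, ?_, hchart⟩
  · obtain ⟨i, hi⟩ := hdf
    exact ⟨i, by rwa [← hgrad]⟩
  · obtain ⟨s, t, hst⟩ := hspan
    exact ⟨s, t, fun i => by rw [← hgrad, hst]⟩

/-- **Affine form of the kernel incidence** (the system as printed in §3.1 Step 4): for an affine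
determinantal representation `f = det (A₀ + Σᵢ xᵢ Aᵢ)` (`IsAffineDetRepr f A`), every polar point
`x ∈ T_f(a, b, c)` carries non-zero kernel vectors `uᵀ A(x) = 0`, `A(x) v = 0` whose kernel pairing
`(uᵀ Aᵢ v)ᵢ` with the CONSTANT coefficient matrices `Aᵢ` is a non-zero covector on the pencil
`ℂ a + ℂ b`. [cite: Sheshadri2026Border, §3.1 Steps 2, 4] -/
theorem polarSet_subset_kernelIncidence_of_isAffineDetRepr {f : MvPolynomial σ ℂ}
    {A : Matrix (Fin k) (Fin k) (MvPolynomial σ ℂ)} (hA : IsAffineDetRepr f A) (a b c : σ → ℂ) :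
    polarSet f a b c ⊆ {x | ∃ u v : Fin k → ℂ, u ≠ 0 ∧ v ≠ 0 ∧ u ᵥ* A.map (eval x) = 0 ∧
      A.map (eval x) *ᵥ v = 0 ∧
      (∃ i, u ⬝ᵥ (A.map (fun p => p.coeff (Finsupp.single i 1)) *ᵥ v) ≠ 0) ∧
      (∃ s t : ℂ, ∀ i,
        u ⬝ᵥ (A.map (fun p => p.coeff (Finsupp.single i 1)) *ᵥ v) = s * a i + t * b i) ∧
      ∑ i, c i * x i = 1} := by
  intro x hx
  have hdet : A.det = f := by
    obtain ⟨-, h⟩ := hA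
    exact h
  obtain ⟨u, v, hu, hv, huM, hMv, hne, hspan, hchart⟩ := polarSet_subset_kernelIncidence hdet a b c hx
  simp only [map_eval_pderiv_eq_of_isAffineDetRepr hA] at hne hspan
  exact ⟨u, v, hu, hv, huM, hMv, hne, hspan, hchart⟩

/-- In particular (Lemma 2, (a) ⇒ (c), pointwise): at a polar point of `f = det A` the matrix
`A(x)` has corank exactly one. [cite: Sheshadri2026Border, Lemma 2] -/
theorem rank_map_eval_of_mem_polarSet {f : MvPolynomial σ ℂ}
    {A : Matrix (Fin k) (Fin k) (MvPolynomial σ ℂ)} (hA : A.det = f) {a b c x : σ → ℂ}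
    (hx : x ∈ polarSet f a b c) : (A.map (eval x)).rank = k - 1 := by
  subst hA
  exact rank_map_eval_of_eval_pderiv_ne_zero A hx.1 hx.2.1

end PolarSet

end DeterminantalConormal

/-! ### The reindexed closed form and the estimates of Lemma 18 -/

/-- Reindexing `j = i − 1`: `B(m, N) = Σ_{j=0}^{N−2} C(m, j+1) · C(m−1, N−2−j) · C(N−2, j)`, the
spelling of the closed form used by route `ValiantsHypothesis/PermanentClass`
(`KernelIncidenceBound`, `BezoutToSuperquadratic`); cf. Remark 3 of the paper ("the coefficient
polynomials agree under the reindexing `a = i − 1`"). [cite: Sheshadri2026Border, Thm. 3 (i), Step 6] -/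
theorem conormalBezout_eq_sum_range (m N : ℕ) :
    conormalBezout m N = ∑ j ∈ Finset.range (N - 1),
      m.choose (j + 1) * (m - 1).choose (N - 2 - j) * (N - 2).choose j := by
  unfold conormalBezout
  refine Finset.sum_nbij' (fun i => i - 1) (fun j => j + 1) ?_ ?_ ?_ ?_ ?_
  · intro i hi
    rw [Finset.mem_Icc] at hi
    rw [Finset.mem_range]
    omega
  · intro j hj
    rw [Finset.mem_range] at hj
    rw [Finset.mem_Icc]
    omega
  · intro i hi
    rw [Finset.mem_Icc] at hi
    show i - 1 + 1 = i
    omega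
  · intro j _
    show j + 1 - 1 = j
    omega
  · intro i hi
    rw [Finset.mem_Icc] at hi
    show _ = m.choose (i - 1 + 1) * (m - 1).choose (N - 2 - (i - 1)) * (N - 2).choose (i - 1)
    rw [Nat.sub_add_cancel hi.1, show N - 2 - (i - 1) = N - 1 - i by omega]

/-- **Lemma 18, first estimate**: `B(m, N) ≤ 2^{N−2} · C(2m−1, N−1)` — bound
`C(N−2, i−1) ≤ 2^{N−2}` termwise and sum the remaining products by Vandermonde,
`Σᵢ C(m, i) C(m−1, N−1−i) = C(2m−1, N−1)` (of which `B(m,N)/2^{N−2}` retains a sub-sum).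
(The paper states it for `n ≥ 3`, `m ≥ n`; it holds for all `m, N`, with `2m − 1` read in `ℕ`.)
[cite: Sheshadri2026Border, Lemma 18] -/
theorem conormalBezout_le_two_pow_mul_choose (m N : ℕ) :
    conormalBezout m N ≤ 2 ^ (N - 2) * (2 * m - 1).choose (N - 1) := by
  rcases Nat.eq_zero_or_pos m with rfl | hm
  · rw [conormalBezout, Finset.sum_eq_zero]
    · exact Nat.zero_le _
    · intro i hi
      rw [Finset.mem_Icc] at hi
      rw [Nat.choose_eq_zero_of_lt (by omega : 0 < i), zero_mul, zero_mul]
  rcases Nat.eq_zero_or_pos N with rfl | hN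
  · simp [conormalBezout]
  calc conormalBezout m N
      ≤ ∑ i ∈ Finset.Icc 1 (N - 1), m.choose i * (m - 1).choose (N - 1 - i) * 2 ^ (N - 2) :=
        Finset.sum_le_sum fun i _ => Nat.mul_le_mul_left _ (Nat.choose_le_two_pow _ _)
    _ = 2 ^ (N - 2) * ∑ i ∈ Finset.Icc 1 (N - 1), m.choose i * (m - 1).choose (N - 1 - i) := by
        rw [Finset.mul_sum]
        exact Finset.sum_congr rfl fun i _ => by ring
    _ ≤ 2 ^ (N - 2) * ∑ i ∈ Finset.range (N - 1 + 1), m.choose i * (m - 1).choose (N - 1 - i) := by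
        refine Nat.mul_le_mul_left _ (Finset.sum_le_sum_of_subset_of_nonneg ?_ fun _ _ _ => ?_)
        · intro i hi
          rw [Finset.mem_Icc] at hi
          rw [Finset.mem_range]
          omega
        · exact Nat.zero_le _
    _ = 2 ^ (N - 2) * (2 * m - 1).choose (N - 1) := by
        congr 1
        rw [show 2 * m - 1 = m + (m - 1) by omega, Nat.add_choose_eq,
          Finset.Nat.sum_antidiagonal_eq_sum_range_succ_mk]

/-- **Lemma 18, second estimate**: for `N ≥ 2`,
`B(m, N) ≤ 2^{N−2} C(2m−1, N−1) ≤ (4 e m / (N−1))^{N−1}`, via `C(a, k) ≤ aᵏ/k!` and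
`kᵏ/k! ≤ eᵏ` (i.e. `C(a,k) ≤ (e a/k)ᵏ`) with `k = N − 1`, `a = 2m − 1 ≤ 2m`, and
`2^{N−2} ≤ 2^{N−1}`. Taking `(N−1)`-st roots of `class ≤ B(m, N)` is how the paper (and route
`ValiantsHypothesis/PermanentClass`, item `BezoutToSuperquadratic`) converts the polar count into
a lower bound on `m`. [cite: Sheshadri2026Border, Lemma 18] -/
theorem conormalBezout_le_pow {m N : ℕ} (hN : 2 ≤ N) :
    (conormalBezout m N : ℝ) ≤ (4 * Real.exp 1 * m / (N - 1)) ^ (N - 1) := by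
  obtain ⟨k, rfl⟩ : ∃ k, N = k + 1 := ⟨N - 1, by omega⟩
  have hk1 : 1 ≤ k := by omega
  simp only [Nat.add_sub_cancel, Nat.cast_add, Nat.cast_one, add_sub_cancel_right]
  have hkpos : (0 : ℝ) < (k : ℝ) := by exact_mod_cast hk1
  have hkk : (0 : ℝ) < (k : ℝ) ^ k := pow_pos hkpos k
  -- Step 1 (ℕ): B ≤ 2^{k-1} C(2m-1, k)
  have h1 : (conormalBezout m (k + 1) : ℝ) ≤ (2 : ℝ) ^ (k - 1) * ((2 * m - 1).choose k : ℝ) := by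
    have h := conormalBezout_le_two_pow_mul_choose m (k + 1)
    rw [Nat.add_sub_cancel, show k + 1 - 2 = k - 1 by omega] at h
    exact_mod_cast h
  -- Step 2: C(2m-1, k) ≤ (2m)^k / k!
  have h2 : ((2 * m - 1).choose k : ℝ) ≤ (2 * (m : ℝ)) ^ k / (k.factorial : ℝ) := by
    calc ((2 * m - 1).choose k : ℝ) ≤ ((2 * m - 1 : ℕ) : ℝ) ^ k / (k.factorial : ℝ) :=
          Nat.choose_le_pow_div k (2 * m - 1)
      _ ≤ (2 * (m : ℝ)) ^ k / (k.factorial : ℝ) := by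
          gcongr
          exact_mod_cast Nat.sub_le (2 * m) 1
  -- Step 3: 1/k! ≤ eᵏ/kᵏ
  have h3 : (k : ℝ) ^ k / (k.factorial : ℝ) ≤ Real.exp 1 ^ k := by
    calc (k : ℝ) ^ k / (k.factorial : ℝ) ≤ Real.exp k :=
          Real.pow_div_factorial_le_exp (x := (k : ℝ)) hkpos.le k
      _ = Real.exp 1 ^ k := by rw [← Real.exp_nat_mul, mul_one]
  have h4 : ((k.factorial : ℕ) : ℝ)⁻¹ ≤ Real.exp 1 ^ k / (k : ℝ) ^ k := by
    have : ((k.factorial : ℕ) : ℝ)⁻¹ = ((k : ℝ) ^ k / (k.factorial : ℝ)) / (k : ℝ) ^ k := by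
      field_simp
    rw [this]
    exact div_le_div_of_nonneg_right h3 hkk.le
  -- Step 4: assemble
  calc (conormalBezout m (k + 1) : ℝ)
      ≤ (2 : ℝ) ^ (k - 1) * ((2 * m - 1).choose k : ℝ) := h1
    _ ≤ (2 : ℝ) ^ k * ((2 * (m : ℝ)) ^ k / (k.factorial : ℝ)) := by
        gcongr
        · norm_num
        · omega
    _ = (2 : ℝ) ^ k * (2 * (m : ℝ)) ^ k * ((k.factorial : ℕ) : ℝ)⁻¹ := by
        rw [div_eq_mul_inv, mul_assoc]
    _ ≤ (2 : ℝ) ^ k * (2 * (m : ℝ)) ^ k * (Real.exp 1 ^ k / (k : ℝ) ^ k) := by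
        gcongr
    _ = (2 * (2 * (m : ℝ)) * (Real.exp 1 / k)) ^ k := by
        simp only [mul_pow, div_pow]
    _ = (4 * Real.exp 1 * m / k) ^ k := by
        congr 1
        ring


/-! ### The degenerate range `2m < N`: generic polar sets of affine determinants are empty

For `2m < N` the bound `B(m, N)` vanishes (`conormalBezout_eq_zero_of_lt`), and in that range the
fact `Sheshadri2026_polarCount_le` asserts that the generic polar set is empty (or infinite). This
much is provable without intersection theory and is done here: it is the elementary avatar of the
classical observation behind Landsberg–Manivel–Ressayre's Theorem 1.2.1 ("`dc̄(P) ≥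
(dim Z(P)^* + 1)/2`": hypersurfaces of small determinantal complexity have degenerate duals) —
by the kernel lift, every covector `∇f(x)`, `f = det(A₀ + Σ xᵢAᵢ)`, is a kernel pairing
`(uᵀAᵢv)ᵢ`, so the Gauss image of `V(f)` lies in the linear image of the rank-one matrices, a
cone of dimension `≤ 2m − 1`, which a generic `2`-plane `ℂa + ℂb ⊂ ℂ^N` avoids as soon as
`2m − 1 + 2 ≤ N`, i.e. `2m < N`. Genericity is obtained by a dimension count made effective through
transcendence degree: `2N + 2m` polynomial functions cannot parametrise a Zariski-dense subset of
`ℂ^{3N}` when `2N + 2m < 3N` (`exists_ne_zero_eval_comp_eq_zero`). -/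

section DegenerateRange

namespace DeterminantalConormal

universe u

/-- **Images of low-dimensional polynomial maps lie on hypersurfaces.** If `|ι| < |κ|` then for
every polynomial map `P : K^ι → K^κ` (given by `κ` polynomials in the variables `ι`) there is a
non-zero polynomial `Φ` on `K^κ` vanishing on the image of `P`: the `|κ|` polynomials `P_k` are
algebraically dependent over `K`, since `trdeg_K K[x_ι] = |ι|`
(`MvPolynomial.trdeg_of_isDomain`, `AlgebraicIndependent.cardinalMk_le_trdeg`). [folklore] -/
theorem exists_ne_zero_eval_comp_eq_zero {K : Type u} [Field K] {ι κ : Type u} [Fintype ι]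
    [Fintype κ] (h : Fintype.card ι < Fintype.card κ) (P : κ → MvPolynomial ι K) :
    ∃ Φ : MvPolynomial κ K, Φ ≠ 0 ∧ ∀ y : ι → K, eval (fun k => eval y (P k)) Φ = 0 := by
  have hdep : ¬ AlgebraicIndependent K P := by
    intro hP
    have h1 := hP.cardinalMk_le_trdeg
    rw [MvPolynomial.trdeg_of_isDomain, Cardinal.mk_fintype, Cardinal.mk_fintype,
      Cardinal.lift_natCast, Nat.cast_le] at h1
    omega
  rw [algebraicIndependent_iff] at hdep
  push Not at hdep
  obtain ⟨Φ, hΦ, hne⟩ := hdep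
  refine ⟨Φ, hne, fun y => ?_⟩
  have h2 := congrArg (aeval y) hΦ
  rw [map_zero, aeval_eq_bind₁, aeval_bind₁] at h2
  exact h2

/-- **Core of the dimension count** (one chart per coordinate `u_j = 1` of the left kernel
vector): for `2m < N = |σ|` and any `N` matrices `Bᵢ ∈ K^{m×m}` there is a non-zero polynomial
`Φ₀` in the pencil/chart data `U = (a, b, c) ∈ (ℂ^σ)³` such that, whenever `Φ₀(U) ≠ 0`, no kernel
pairing `(uᵀBᵢv)ᵢ` with `u ≠ 0` can be written `s·a + t·b` with `s ≠ 0`. (The `2m` polynomial maps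
`(u|_{u_j=1}, v, t', b, c) ↦ (φ(u,v) + t'b, b, c)`, `ℂ^{2N+2m} → ℂ^{3N}`, have images on
hypersurfaces `Φ_j = 0` by `exists_ne_zero_eval_comp_eq_zero`; `Φ₀ = Π_j Φ_j`.) [folklore] -/
theorem exists_ne_zero_forall_kernelPairing_ne {σ : Type} [Fintype σ] [DecidableEq σ] {m : ℕ}
    (hm : 2 * m < Fintype.card σ) (B : σ → Matrix (Fin m) (Fin m) ℂ) :
    ∃ Φ₀ : MvPolynomial (Fin 3 × σ) ℂ, Φ₀ ≠ 0 ∧ ∀ U : Fin 3 × σ → ℂ, eval U Φ₀ ≠ 0 →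
      ∀ (u v : Fin m → ℂ) (s t : ℂ), u ≠ 0 → s ≠ 0 →
        ¬ ∀ i, u ⬝ᵥ (B i *ᵥ v) = s * U (0, i) + t * U (1, i) := by
  -- one polynomial per chart `u j = 1`
  have key : ∀ j : Fin m, ∃ Φ : MvPolynomial (Fin 3 × σ) ℂ, Φ ≠ 0 ∧ ∀ U : Fin 3 × σ → ℂ,
      eval U Φ ≠ 0 → ∀ (u v : Fin m → ℂ) (t : ℂ), u j = 1 →
        ¬ ∀ i, U (0, i) = u ⬝ᵥ (B i *ᵥ v) + t * U (1, i) := by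
    intro j
    -- source variables: `u` off the chart coordinate, `v`, `t`, `b`, `c`
    let V : Type := ({i : Fin m // i ≠ j} ⊕ Fin m) ⊕ (Unit ⊕ (σ ⊕ σ))
    let uP : Fin m → MvPolynomial V ℂ := fun i =>
      if h : i = j then 1 else X (Sum.inl (Sum.inl ⟨i, h⟩))
    let vP : Fin m → MvPolynomial V ℂ := fun i => X (Sum.inl (Sum.inr i))
    let P : Fin 3 × σ → MvPolynomial V ℂ := fun k =>
      if k.1 = 0 then uP ⬝ᵥ ((B k.2).map C *ᵥ vP) +
          X (Sum.inr (Sum.inl ())) * X (Sum.inr (Sum.inr (Sum.inl k.2)))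
      else if k.1 = 1 then X (Sum.inr (Sum.inr (Sum.inl k.2)))
      else X (Sum.inr (Sum.inr (Sum.inr k.2)))
    have hcard : Fintype.card V < Fintype.card (Fin 3 × σ) := by
      have hsub : Fintype.card {i : Fin m // i ≠ j} = m - 1 := by
        simp [Fintype.card_subtype_compl]
      have hmpos : 0 < m := j.pos
      simp only [V, Fintype.card_sum, Fintype.card_prod, Fintype.card_fin, Fintype.card_unit,
        hsub]
      omega
    obtain ⟨Φ, hΦ, hvan⟩ := exists_ne_zero_eval_comp_eq_zero hcard P
    refine ⟨Φ, hΦ, fun U hU u v t huj hrel => hU ?_⟩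
    -- the point of the source mapping to `U`
    let y : V → ℂ := Sum.elim (Sum.elim (fun i => u i.1) v)
      (Sum.elim (fun _ => t) (Sum.elim (fun i => U (1, i)) (fun i => U (2, i))))
    have huP : (fun i => eval y (uP i)) = u := by
      funext i
      by_cases h : i = j
      · subst h
        simp [uP, huj]
      · simp [uP, h, y]
    have hvP : (fun i => eval y (vP i)) = v := by
      funext i
      simp [vP, y]
    have hφ : ∀ i, eval y (uP ⬝ᵥ ((B i).map C *ᵥ vP)) = u ⬝ᵥ (B i *ᵥ v) := by
      intro i
      rw [RingHom.map_dotProduct]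
      have h1 : (eval y) ∘ uP = u := huP
      have h2 : (eval y) ∘ ((B i).map C *ᵥ vP) = B i *ᵥ v := by
        funext r
        rw [Function.comp_apply, RingHom.map_mulVec, Matrix.map_map]
        have h3 : (B i).map (⇑(eval y) ∘ ⇑C) = B i := by
          ext r' c'
          simp
        have h4 : (eval y) ∘ vP = v := hvP
        rw [h3, h4]
      rw [h1, h2]
    have hy : (fun k => eval y (P k)) = U := by
      funext ⟨r, i⟩
      fin_cases r
      · simp only [P, Fin.zero_eta, Fin.isValue, ↓reduceIte, map_add, map_mul, eval_X]
        rw [hφ i, hrel i]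
        simp [y]
      · simp [P, y]
      · simp [P, y]
    rw [← hy]
    exact hvan y
  choose Φf hΦf hmain using key
  refine ⟨∏ j, Φf j, Finset.prod_ne_zero_iff.mpr fun j _ => hΦf j, ?_⟩
  intro U hU u v s t hu hs hrel
  obtain ⟨j, hj⟩ := Function.ne_iff.mp hu
  have hj' : u j ≠ 0 := by simpa using hj
  have hUj : eval U (Φf j) ≠ 0 := by
    rw [map_prod] at hU
    exact Finset.prod_ne_zero_iff.mp hU j (Finset.mem_univ j)
  -- normalise: `u ↦ (u j)⁻¹ u` (so that `u j = 1`), `v ↦ (s⁻¹ u j) v`, `t ↦ -(s⁻¹ t)`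
  refine hmain j U hUj ((u j)⁻¹ • u) ((s⁻¹ * u j) • v) (-(s⁻¹ * t)) ?_ fun i => ?_
  · rw [Pi.smul_apply, smul_eq_mul, inv_mul_cancel₀ hj']
  · rw [Matrix.mulVec_smul, dotProduct_smul, smul_dotProduct, hrel i, smul_eq_mul, smul_eq_mul]
    field_simp
    ring

/-- **Generic polar sets of small affine determinants are empty** (the degenerate range of
`Sheshadri2026_polarCount_le`; elementary avatar of Landsberg–Manivel–Ressayre 2013, §1.2 and
Theorem 1.2.1, "`dc̄(P) ≥ (dim Z(P)^* + 1)/2`" — small determinantal complexity forces a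
degenerate dual): let `f = det A` for an `m × m` matrix `A` of affine-linear forms in `N = |σ|`
variables with `2m < N`. Then there is a non-zero polynomial `Φ` in the pencil/chart data
`U = (a, b, c)` such that `Φ(U) ≠ 0` implies `T_f(a, b, c) = ∅`: no point `x` with `f(x) = 0`,
`∇f(x) ≠ 0` has its tangent hyperplane on the pencil `ℂa + ℂb`. Proof: kernel lift
(`polarSet_subset_kernelIncidence_of_isAffineDetRepr`) + `exists_ne_zero_forall_kernelPairing_ne`
applied to `U` (case `s ≠ 0`) and to `U` with `a, b` swapped (case `t ≠ 0`). No homogeneity of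
`f` is needed. [cite: LandsbergManivelRessayre2013, §1.2, Theorem 1.2.1] -/
theorem exists_generic_polarSet_eq_empty_of_two_mul_lt {σ : Type} [Fintype σ] [DecidableEq σ]
    {f : MvPolynomial σ ℂ} {m : ℕ} (hm : 2 * m < Fintype.card σ) (hf : HasDetRepr f m) :
    ∃ Φ : MvPolynomial (Fin 3 × σ) ℂ, Φ ≠ 0 ∧ ∀ U : Fin 3 × σ → ℂ, eval U Φ ≠ 0 →
      polarSet f (fun i => U (0, i)) (fun i => U (1, i)) (fun i => U (2, i)) = ∅ := by
  obtain ⟨A, hA⟩ := hf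
  obtain ⟨Φ₀, hΦ₀, hcore⟩ := exists_ne_zero_forall_kernelPairing_ne hm
    (fun i => A.map (fun p => p.coeff (Finsupp.single i 1)))
  -- swapping the two pencil vectors `a ↔ b`
  let e : Fin 3 × σ ≃ Fin 3 × σ := Equiv.prodCongr (Equiv.swap 0 1) (Equiv.refl σ)
  refine ⟨Φ₀ * rename e Φ₀, mul_ne_zero hΦ₀ ?_, fun U hU => ?_⟩
  · exact (map_ne_zero_iff _ (rename_injective _ e.injective)).mpr hΦ₀
  · rw [map_mul, mul_ne_zero_iff, eval_rename] at hU
    obtain ⟨hU0, hU1⟩ := hU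
    refine Set.eq_empty_iff_forall_notMem.mpr fun x hx => ?_
    obtain ⟨u, v, hu, -, -, -, ⟨i₀, hi₀⟩, ⟨s, t, hst⟩, -⟩ :=
      polarSet_subset_kernelIncidence_of_isAffineDetRepr hA _ _ _ hx
    by_cases hs : s = 0
    · have ht : t ≠ 0 := by
        rintro rfl
        apply hi₀
        rw [hst i₀, hs, zero_mul, zero_mul, add_zero]
      refine hcore (U ∘ e) hU1 u v t s hu ht fun i => ?_
      have h0 : (U ∘ e) (0, i) = U (1, i) := by simp [e]
      have h1 : (U ∘ e) (1, i) = U (0, i) := by simp [e]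
      rw [h0, h1, hst i, add_comm]
    · exact hcore U hU0 u v s t hu hs hst

end DeterminantalConormal

/-- **`Sheshadri2026_polarCount_le` in its degenerate range.** For `2m < N = |σ|` — exactly the
range where `B(m, N) = 0` (`conormalBezout_eq_zero_of_lt`) — the conclusion of the named fact
`Sheshadri2026_polarCount_le` holds (indeed with an empty generic polar set, and without the
hypotheses `N ≥ 3` and `f` homogeneous): proved from
`DeterminantalConormal.exists_generic_polarSet_eq_empty_of_two_mul_lt`. The complementary range `N ≤ 2m` is the
content of arXiv:2606.13628 Thm. 3 (i) proper (multihomogeneous Bézout count, Lemmas 4–5 there)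
and is not formalised. [cite: LandsbergManivelRessayre2013, §1.2, Theorem 1.2.1] -/
theorem Sheshadri2026_polarCount_le_of_two_mul_lt {σ : Type} [Fintype σ] [DecidableEq σ]
    (f : MvPolynomial σ ℂ) (m : ℕ) (hm : 2 * m < Fintype.card σ) (hf : HasDetRepr f m) :
    ∃ Φ : MvPolynomial (Fin 3 × σ) ℂ, Φ ≠ 0 ∧ ∀ u : Fin 3 × σ → ℂ, eval u Φ ≠ 0 →
      (polarSet f (fun i => u (0, i)) (fun i => u (1, i)) (fun i => u (2, i))).ncard ≤
        conormalBezout m (Fintype.card σ) := by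
  obtain ⟨Φ, hΦ, h⟩ := DeterminantalConormal.exists_generic_polarSet_eq_empty_of_two_mul_lt hm hf
  exact ⟨Φ, hΦ, fun u hu => by rw [h u hu, Set.ncard_empty]; exact Nat.zero_le _⟩

end DegenerateRange


/-! ### §3.1 Step 5 (ii)–(iii): the local normal form of the kernel incidence

The bordered matrix `Â = [[B, c], [r, s]]` with `B` invertible (the paper's "leading
`(m−1) × (m−1)` block invertible", arranged by constant row/column operations), in the affine
charts `u_m = 1`, `v_m = 1` of the two kernel factors, the right block reduced by
`Λ = [Λ_top | λ]`. Everything below is an identity of matrices over a commutative ring `R` (for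
the paper: the local ring `O_{x*}` or its residue field), indexed by `n ⊕ Unit` (`n` = the leading
block; `Matrix.fromBlocks B c r s`, `Matrix.fromCols Λ_top λ`). Proved following the paper: the
Schur identity `det Â = det B · g`, `g = s − r B⁻¹ c` (`det_border_eq`); the two kernels are the
lines through `v = (−B⁻¹c, 1)` and `u = (−rB⁻¹, 1)` (`eq_smul_of_border_mulVec_eq_zero`,
`eq_smul_of_vecMul_border_eq_zero`); the left block `(u', 1) Â = 0 ⇔ u' = −rB⁻¹ ∧ g = 0`
(`sumElim_vecMul_border_eq_zero_iff`); the exact identity `Λ Â (v', 1)ᵀ = M_v z + g λ`,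
`z = v' + B⁻¹c`, `M_v = Λ_top B + λ r` (`fromCols_mulVec_border_mulVec_sumElim`); hence for
`M_v` invertible (the genericity condition (3.4) on `Λ`) the bilinear block cuts out exactly the
graph `u' = −rB⁻¹, v' = −B⁻¹c` over `{g = 0}` (`kernelBlock_chart_iff`); and on `{g = 0}` the
conormal identity `adj Â = det B · v uᵀ` (`adjugate_border_eq`), whence by Jacobi
`tr(adj Â · N) = det B · uᵀ N v` for every direction matrix `N = Âᵢ`
(`trace_adjugate_border_mul`). -/

section LocalNormalForm

namespace DeterminantalConormal

variable {R : Type*} [CommRing R] {n : Type*}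

/-- `Sum.elim f g = 0` on `n ⊕ Unit` unfolds to `f = 0 ∧ g () = 0`. [folklore] -/
theorem sumElim_eq_zero_iff (f : n → R) (g : Unit → R) :
    Sum.elim f g = 0 ↔ f = 0 ∧ g () = 0 := by
  constructor
  · intro h
    exact ⟨funext fun i => congrFun h (Sum.inl i), congrFun h (Sum.inr ())⟩
  · rintro ⟨hf, hg⟩
    funext i
    rcases i with i | ⟨⟩
    · simp [hf]
    · simpa using hg

/-- A `Unit`-column block acts by scaling: `(c as a column) · w = w() · c`. [folklore] -/
theorem colUnit_mulVec (c : n → R) (w : Unit → R) :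
    (Matrix.of fun i (_ : Unit) => c i) *ᵥ w = w () • c := by
  funext i
  simp [Matrix.mulVec, dotProduct, mul_comm]

/-- A `Unit`-row block acts by the dot product: `(r as a row) · w = (r ⬝ w)`. [folklore] -/
theorem rowUnit_mulVec [Fintype n] (r w : n → R) :
    (Matrix.of fun (_ : Unit) j => r j) *ᵥ w = fun _ => r ⬝ᵥ w := by
  funext i
  simp [Matrix.mulVec, dotProduct]

/-- Dually for `vecMul`: `w · (r as a row) = w() · r`. [folklore] -/
theorem vecMul_rowUnit (r : n → R) (w : Unit → R) :
    w ᵥ* (Matrix.of fun (_ : Unit) j => r j) = w () • r := by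
  funext j
  simp [Matrix.vecMul, dotProduct]

/-- Dually for `vecMul`: `w · (c as a column) = (w ⬝ c)`. [folklore] -/
theorem vecMul_colUnit [Fintype n] (c w : n → R) :
    w ᵥ* (Matrix.of fun i (_ : Unit) => c i) = fun _ => w ⬝ᵥ c := by
  funext i
  simp [Matrix.vecMul, dotProduct]

/-- The outer product acts by `(λ rᵀ) w = (r ⬝ w) λ`. [folklore] -/
theorem vecMulVec_mulVec_eq_smul [Fintype n] (lam r w : n → R) :
    vecMulVec lam r *ᵥ w = (r ⬝ᵥ w) • lam := by
  funext t
  simp [Matrix.mulVec, dotProduct, vecMulVec_apply, Finset.mul_sum, mul_comm, mul_left_comm]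

/-- The `1 × 1` corner block acts by `s`. [folklore] -/
theorem unitUnit_mulVec (s : R) (w : Unit → R) :
    (Matrix.of fun (_ _ : Unit) => s) *ᵥ w = fun _ => s * w () := by
  funext i
  simp [Matrix.mulVec, dotProduct]

variable [Fintype n] [DecidableEq n]

/-- **Schur identity** `det [[B, c], [r, s]] = det B · (s − r B⁻¹ c)` for `B` invertible
(§3.1 Step 5 (ii): "`det Â = (det B) g`, so that `(F) = (g)` in `O_{x*}`"; Mathlib's
`Matrix.det_fromBlocks₁₁` with a `1 × 1` Schur complement). [cite: Sheshadri2026Border, §3.1 Step 5 (ii)] -/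
theorem det_border_eq (B : Matrix n n R) (c r : n → R) (s : R) (hB : IsUnit B.det) :
    (Matrix.fromBlocks B (Matrix.of fun i (_ : Unit) => c i) (Matrix.of fun (_ : Unit) j => r j)
        (Matrix.of fun (_ _ : Unit) => s)).det = B.det * (s - r ⬝ᵥ (B⁻¹ *ᵥ c)) := by
  letI := Matrix.invertibleOfIsUnitDet B hB
  have h1 : ∀ D : Matrix Unit Unit R, D.det = D () () := fun D => Matrix.det_unique D
  rw [Matrix.det_fromBlocks₁₁, h1, Matrix.invOf_eq_nonsing_inv]
  congr 1
  simp only [Matrix.sub_apply, Matrix.of_apply, Matrix.mul_apply, dotProduct, Matrix.mulVec,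
    Finset.sum_mul, Finset.mul_sum]
  congr 1
  rw [Finset.sum_comm]
  exact Finset.sum_congr rfl fun x _ => Finset.sum_congr rfl fun y _ => by ring

/-- **Right kernel of the bordered matrix** (`B` invertible): `Â x = 0` forces
`x = x_m · (−B⁻¹c, 1)` — "a kernel vector with vanishing last coordinate is annihilated by the
invertible `B` and dies": the right kernel is the line through `v = (−B⁻¹c, 1)`.
[cite: Sheshadri2026Border, §3.1 Step 5 (ii)] -/
theorem eq_smul_of_border_mulVec_eq_zero (B : Matrix n n R) (c r : n → R) (s : R)
    (hB : IsUnit B.det) {x : n ⊕ Unit → R}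
    (hx : Matrix.fromBlocks B (Matrix.of fun i (_ : Unit) => c i)
        (Matrix.of fun (_ : Unit) j => r j) (Matrix.of fun (_ _ : Unit) => s) *ᵥ x = 0) :
    x = x (Sum.inr ()) • Sum.elim (-(B⁻¹ *ᵥ c)) (fun _ => (1 : R)) := by
  rw [Matrix.fromBlocks_mulVec, sumElim_eq_zero_iff, colUnit_mulVec] at hx
  obtain ⟨h1, -⟩ := hx
  have h2 : x ∘ Sum.inl = -(x (Sum.inr ()) • (B⁻¹ *ᵥ c)) := by
    have h3 : B⁻¹ *ᵥ (B *ᵥ (x ∘ Sum.inl)) = x ∘ Sum.inl := by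
      rw [Matrix.mulVec_mulVec, Matrix.nonsing_inv_mul B hB, Matrix.one_mulVec]
    rw [← h3, eq_neg_iff_add_eq_zero, ← Matrix.mulVec_smul, ← Matrix.mulVec_add]
    have h4 : x ∘ Sum.inr = fun _ => x (Sum.inr ()) := funext fun _ => rfl
    rw [h4] at h1
    rw [h1, Matrix.mulVec_zero]
  funext i
  rcases i with i | ⟨⟩
  · have := congrFun h2 i
    simp only [Function.comp_apply, Pi.neg_apply, Pi.smul_apply, smul_eq_mul] at this
    simp [this]
  · simp

/-- **Left kernel of the bordered matrix** (`B` invertible): `y Â = 0` forces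
`y = y_m · (−rB⁻¹, 1)`: the left kernel is the line through `u = (−rB⁻¹, 1)`.
[cite: Sheshadri2026Border, §3.1 Step 5 (ii)] -/
theorem eq_smul_of_vecMul_border_eq_zero (B : Matrix n n R) (c r : n → R) (s : R)
    (hB : IsUnit B.det) {y : n ⊕ Unit → R}
    (hy : y ᵥ* Matrix.fromBlocks B (Matrix.of fun i (_ : Unit) => c i)
        (Matrix.of fun (_ : Unit) j => r j) (Matrix.of fun (_ _ : Unit) => s) = 0) :
    y = y (Sum.inr ()) • Sum.elim (-(r ᵥ* B⁻¹)) (fun _ => (1 : R)) := by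
  rw [Matrix.vecMul_fromBlocks, sumElim_eq_zero_iff, vecMul_rowUnit] at hy
  obtain ⟨h1, -⟩ := hy
  have h2 : y ∘ Sum.inl = -(y (Sum.inr ()) • (r ᵥ* B⁻¹)) := by
    have h3 : (y ∘ Sum.inl) ᵥ* B ᵥ* B⁻¹ = y ∘ Sum.inl := by
      rw [Matrix.vecMul_vecMul, Matrix.mul_nonsing_inv B hB, Matrix.vecMul_one]
    rw [← h3, eq_neg_iff_add_eq_zero, ← Matrix.smul_vecMul, ← Matrix.add_vecMul]
    have h4 : (y ∘ Sum.inr) () = y (Sum.inr ()) := rfl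
    rw [h4] at h1
    rw [h1, Matrix.zero_vecMul]
  funext i
  rcases i with i | ⟨⟩
  · have := congrFun h2 i
    simp only [Function.comp_apply, Pi.neg_apply, Pi.smul_apply, smul_eq_mul] at this
    simp [this]
  · simp

/-- **Left block in the chart `u_m = 1`** (§3.1 Step 5 (ii), "Left block"): for `B` invertible,
`(u', 1) Â = 0 ⇔ u' = −r B⁻¹ ∧ g = 0` with `g = s − r B⁻¹ c` — the first `m − 1` equations
generate `u'ᵀ + rB⁻¹`, and modulo these the last one becomes `g`. [cite: Sheshadri2026Border, §3.1 Step 5 (ii)] -/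
theorem sumElim_vecMul_border_eq_zero_iff (B : Matrix n n R) (c r : n → R) (s : R)
    (hB : IsUnit B.det) (u' : n → R) :
    Sum.elim u' (fun _ => (1 : R)) ᵥ* Matrix.fromBlocks B (Matrix.of fun i (_ : Unit) => c i)
        (Matrix.of fun (_ : Unit) j => r j) (Matrix.of fun (_ _ : Unit) => s) = 0 ↔
      u' = -(r ᵥ* B⁻¹) ∧ s - r ⬝ᵥ (B⁻¹ *ᵥ c) = 0 := by
  have key : ∀ w : n → R, Sum.elim w (fun _ => (1 : R)) ᵥ* Matrix.fromBlocks B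
      (Matrix.of fun i (_ : Unit) => c i) (Matrix.of fun (_ : Unit) j => r j)
      (Matrix.of fun (_ _ : Unit) => s) = Sum.elim (w ᵥ* B + r) (fun _ => w ⬝ᵥ c + s) := by
    intro w
    rw [Matrix.vecMul_fromBlocks, Sum.elim_comp_inl, Sum.elim_comp_inr, vecMul_rowUnit,
      vecMul_colUnit, one_smul]
    congr 1
    funext i
    simp [Matrix.vecMul, dotProduct]
  have hcancel : -(r ᵥ* B⁻¹) ᵥ* B + r = 0 := by
    rw [Matrix.neg_vecMul, Matrix.vecMul_vecMul, Matrix.nonsing_inv_mul B hB, Matrix.vecMul_one,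
      neg_add_cancel]
  have hdot : -(r ᵥ* B⁻¹) ⬝ᵥ c + s = s - r ⬝ᵥ (B⁻¹ *ᵥ c) := by
    rw [neg_dotProduct, ← Matrix.dotProduct_mulVec]
    ring
  rw [key, sumElim_eq_zero_iff]
  constructor
  · rintro ⟨h1, h2⟩
    have hu' : u' = -(r ᵥ* B⁻¹) := by
      have h3 : u' ᵥ* B ᵥ* B⁻¹ = u' := by
        rw [Matrix.vecMul_vecMul, Matrix.mul_nonsing_inv B hB, Matrix.vecMul_one]
      rw [← h3, eq_neg_iff_add_eq_zero, ← Matrix.add_vecMul, h1, Matrix.zero_vecMul]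
    refine ⟨hu', ?_⟩
    rw [hu'] at h2
    rwa [hdot] at h2
  · rintro ⟨hu', hg⟩
    subst hu'
    exact ⟨hcancel, by rw [hdot, hg]⟩

/-- **The exact identity of the right block** (§3.1 Step 5 (ii), "Right block"): with
`z = v' + B⁻¹c` and `g = s − rB⁻¹c` one has `Â (v', 1)ᵀ = (Bz, rz + g)ᵀ`, hence for the
reduction matrix `Λ = [Λ_top | λ]`, `Λ Â (v', 1)ᵀ = M_v z + g λ` with
`M_v = Λ C = Λ_top B + λ r` (`C` = the first `m − 1` columns of `Â`). [cite: Sheshadri2026Border, §3.1 Step 5 (ii)] -/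
theorem fromCols_mulVec_border_mulVec_sumElim (B : Matrix n n R) (c r : n → R) (s : R)
    (hB : IsUnit B.det) (Λt : Matrix n n R) (lam : n → R) (v' : n → R) :
    Matrix.fromCols Λt (Matrix.of fun t (_ : Unit) => lam t) *ᵥ
        (Matrix.fromBlocks B (Matrix.of fun i (_ : Unit) => c i) (Matrix.of fun (_ : Unit) j => r j)
          (Matrix.of fun (_ _ : Unit) => s) *ᵥ Sum.elim v' (fun _ => (1 : R))) =
      (Λt * B + vecMulVec lam r) *ᵥ (v' + B⁻¹ *ᵥ c) + (s - r ⬝ᵥ (B⁻¹ *ᵥ c)) • lam := by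
  have hBinv : B *ᵥ (B⁻¹ *ᵥ c) = c := by
    rw [Matrix.mulVec_mulVec, Matrix.mul_nonsing_inv B hB, Matrix.one_mulVec]
  have h1 : (fun _ : Unit => (1 : R)) () • c = c := one_smul R c
  rw [Matrix.fromBlocks_mulVec, Sum.elim_comp_inl, Sum.elim_comp_inr, colUnit_mulVec, h1,
    rowUnit_mulVec, unitUnit_mulVec, Matrix.fromCols_mulVec, Sum.elim_comp_inl, Sum.elim_comp_inr,
    colUnit_mulVec]
  have hl : ((fun _ : Unit => r ⬝ᵥ v') + fun _ : Unit => s * (fun _ : Unit => (1 : R)) ()) () =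
      r ⬝ᵥ v' + s := by
    simp
  rw [hl, Matrix.add_mulVec, ← Matrix.mulVec_mulVec, Matrix.mulVec_add B v', hBinv,
    vecMulVec_mulVec_eq_smul, dotProduct_add]
  rw [add_assoc, ← add_smul]
  congr 2
  ring

/-- **The bilinear block is the graph over the hypersurface germ** (§3.1 Step 5 (ii),
eq. (3.6): "`I = (u'ᵀ + rB⁻¹, v' + B⁻¹c, g)`", pointwise form): for `B` and
`M_v = Λ_top B + λ r` invertible (the latter is the genericity condition (3.4) on `Λ`), the
left system `(u', 1) Â = 0` together with the `Λ`-reduced right system `Λ Â (v', 1)ᵀ = 0` hold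
iff `u' = −rB⁻¹`, `v' = −B⁻¹c` and `g = s − rB⁻¹c = 0`. [cite: Sheshadri2026Border, §3.1 Step 5 (ii)] -/
theorem kernelBlock_chart_iff (B : Matrix n n R) (c r : n → R) (s : R) (hB : IsUnit B.det)
    (Λt : Matrix n n R) (lam : n → R) (hM : IsUnit (Λt * B + vecMulVec lam r).det)
    (u' v' : n → R) :
    (Sum.elim u' (fun _ => (1 : R)) ᵥ* Matrix.fromBlocks B (Matrix.of fun i (_ : Unit) => c i)
          (Matrix.of fun (_ : Unit) j => r j) (Matrix.of fun (_ _ : Unit) => s) = 0 ∧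
      Matrix.fromCols Λt (Matrix.of fun t (_ : Unit) => lam t) *ᵥ
          (Matrix.fromBlocks B (Matrix.of fun i (_ : Unit) => c i)
            (Matrix.of fun (_ : Unit) j => r j) (Matrix.of fun (_ _ : Unit) => s) *ᵥ
            Sum.elim v' (fun _ => (1 : R))) = 0) ↔
      u' = -(r ᵥ* B⁻¹) ∧ v' = -(B⁻¹ *ᵥ c) ∧ s - r ⬝ᵥ (B⁻¹ *ᵥ c) = 0 := by
  rw [sumElim_vecMul_border_eq_zero_iff B c r s hB,
    fromCols_mulVec_border_mulVec_sumElim B c r s hB]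
  constructor
  · rintro ⟨⟨hu, hg⟩, hright⟩
    refine ⟨hu, ?_, hg⟩
    rw [hg, zero_smul, add_zero] at hright
    have hz : v' + B⁻¹ *ᵥ c = 0 := by
      have h := congrArg (fun w => (Λt * B + vecMulVec lam r)⁻¹ *ᵥ w) hright
      simpa only [Matrix.mulVec_mulVec, Matrix.nonsing_inv_mul _ hM, Matrix.one_mulVec,
        Matrix.mulVec_zero] using h
    exact eq_neg_of_add_eq_zero_left hz
  · rintro ⟨hu, hv, hg⟩
    refine ⟨⟨hu, hg⟩, ?_⟩
    rw [hv, hg, neg_add_cancel, Matrix.mulVec_zero, zero_smul, add_zero]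

/-- **The conormal identity along the graph** (§3.1 Step 5 (iii)): on `{g = 0}` (i.e.
`det Â = 0`) with `B` invertible, `adj Â = det B · v uᵀ` for the explicit kernel sections
`u = (−rB⁻¹, 1)`, `v = (−B⁻¹c, 1)` — "`adj Â = α v uᵀ`; evaluating the `(m, m)` entries pins
the scalar, since `(adj Â)_{mm} = det B` and `(v uᵀ)_{mm} = 1`, giving `α = det B`". (Here
over any commutative ring: the columns of `adj Â` lie in the right kernel, a line, and its last
row in the left kernel.) [cite: Sheshadri2026Border, §3.1 Step 5 (iii)] -/
theorem adjugate_border_eq (B : Matrix n n R) (c r : n → R) (s : R) (hB : IsUnit B.det)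
    (hg : s - r ⬝ᵥ (B⁻¹ *ᵥ c) = 0) :
    (Matrix.fromBlocks B (Matrix.of fun i (_ : Unit) => c i) (Matrix.of fun (_ : Unit) j => r j)
        (Matrix.of fun (_ _ : Unit) => s)).adjugate =
      B.det • vecMulVec (Sum.elim (-(B⁻¹ *ᵥ c)) (fun _ => (1 : R)))
        (Sum.elim (-(r ᵥ* B⁻¹)) (fun _ => (1 : R))) := by
  set M := Matrix.fromBlocks B (Matrix.of fun i (_ : Unit) => c i)
    (Matrix.of fun (_ : Unit) j => r j) (Matrix.of fun (_ _ : Unit) => s) with hMdef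
  have hdet : M.det = 0 := by rw [hMdef, det_border_eq B c r s hB, hg, mul_zero]
  -- columns of `adj M` are right kernel vectors, rows are left kernel vectors
  have hcol : ∀ j, M *ᵥ (fun i => M.adjugate i j) = 0 := fun j => by
    have h := Matrix.mul_adjugate M
    rw [hdet, zero_smul] at h
    funext i
    have hij := congrFun (congrFun h i) j
    simpa [Matrix.mul_apply, Matrix.mulVec, dotProduct] using hij
  have hrow : ∀ i, (fun j => M.adjugate i j) ᵥ* M = 0 := fun i => by
    have h := Matrix.adjugate_mul M
    rw [hdet, zero_smul] at h
    funext j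
    have hij := congrFun (congrFun h i) j
    simpa [Matrix.mul_apply, Matrix.vecMul, dotProduct] using hij
  -- the `(m, m)` entry of `adj M` is `det B`
  have hmm : M.adjugate (Sum.inr ()) (Sum.inr ()) = B.det := by
    rw [Matrix.adjugate_apply]
    have hupd : M.updateRow (Sum.inr ()) (Pi.single (Sum.inr ()) 1) =
        Matrix.fromBlocks B (Matrix.of fun i (_ : Unit) => c i) 0 1 := by
      ext i j
      rcases i with i | ⟨⟩
      · rw [Matrix.updateRow_ne (by simp)]
        rcases j with j | ⟨⟩ <;> simp [hMdef]
      · rw [Matrix.updateRow_self]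
        rcases j with j | ⟨⟩ <;> simp
    rw [hupd, Matrix.det_fromBlocks_zero₂₁, Matrix.det_one, mul_one]
  ext i j
  have hi := eq_smul_of_border_mulVec_eq_zero B c r s hB (hcol j)
  have hj := eq_smul_of_vecMul_border_eq_zero B c r s hB (hrow (Sum.inr ()))
  have e1 : M.adjugate i j =
      M.adjugate (Sum.inr ()) j * Sum.elim (-(B⁻¹ *ᵥ c)) (fun _ => (1 : R)) i := by
    have h := congrFun hi i
    simpa using h
  have e2 : M.adjugate (Sum.inr ()) j =
      B.det * Sum.elim (-(r ᵥ* B⁻¹)) (fun _ => (1 : R)) j := by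
    have h := congrFun hj j
    rw [hmm] at h
    simpa using h
  rw [Matrix.smul_apply, vecMulVec_apply, e1, e2, smul_eq_mul]
  ring

/-- **Jacobi along the graph** (§3.1 Step 5 (iii), last display): on `{g = 0}` with `B`
invertible, `tr(adj Â · N) = det B · uᵀ N v` for every matrix `N` (applied with `N = Âᵢ` and
`eval_pderiv_det` this is "`∂ᵢF(x) = (det B)(x) · u(x)ᵀ Âᵢ v(x)` on `(S_j, x*)`": each polar
equation restricts on the graph to a unit multiple of the flag function). [cite: Sheshadri2026Border, §3.1 Step 5 (iii)] -/
theorem trace_adjugate_border_mul (B : Matrix n n R) (c r : n → R) (s : R) (hB : IsUnit B.det)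
    (hg : s - r ⬝ᵥ (B⁻¹ *ᵥ c) = 0) (N : Matrix (n ⊕ Unit) (n ⊕ Unit) R) :
    ((Matrix.fromBlocks B (Matrix.of fun i (_ : Unit) => c i) (Matrix.of fun (_ : Unit) j => r j)
        (Matrix.of fun (_ _ : Unit) => s)).adjugate * N).trace =
      B.det * (Sum.elim (-(r ᵥ* B⁻¹)) (fun _ => (1 : R)) ⬝ᵥ
        (N *ᵥ Sum.elim (-(B⁻¹ *ᵥ c)) (fun _ => (1 : R)))) := by
  rw [adjugate_border_eq B c r s hB hg, Matrix.smul_mul, Matrix.trace_smul, vecMulVec_mul,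
    Matrix.trace_vecMulVec, dotProduct_comm, ← Matrix.dotProduct_mulVec, smul_eq_mul]

end DeterminantalConormal

end LocalNormalForm

/-! ### §3.1 Step 3: the generic `Λ`-reduction

The incidence conditions at a lift are `uᵀ Â(x) = 0` and `Â(x) v = 0`; over the corank-one locus
one right equation is locally redundant, and the paper replaces the `m` right equations by
`m − 1` generic combinations `Λ Â v = 0`, `Λ : ℂ^m → ℂ^{m−1}` generic subject to the finitely
many open conditions `ker Λ ∩ im Â(x*) = 0` at the count points (condition (3.3)) and to "no row
of `Λ Â` vanishes identically". Below (with `m + 1` for the paper's `m`): at a point, condition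
(3.3) — in the concrete form `det(Λ B) ≠ 0` for an explicit basis `B` of the hyperplane
`n^⊥ ⊇ im A`, `nᵀ A = 0` — makes `Λ A y = 0` equivalent to `A y = 0`
(`mulVec_eq_zero_of_reduction`); both conditions hold for `Λ` outside the zero set of one
non-zero polynomial in the entries of `Λ` (`exists_generic_reduction`,
`exists_generic_rows_ne_zero`). (Remark 1 of the paper — deleting a row instead is unsound
globally — concerns Step 5; the coordinate projection is used here only to show that the
genericity polynomial is not identically zero.) -/

section GenericReduction

namespace DeterminantalConormal

variable {m : ℕ}

/-- **Right reduction at a point (arXiv:2606.13628, §3.1 Step 3).** Let `A` be an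
`(m+1) × (m+1)` matrix over `ℂ` with a non-zero left annihilator `n`, `nᵀ A = 0`, and `n_{i₀} ≠ 0`,
so that `im A ⊆ n^⊥ = im B` for the explicit hyperplane basis
`B = (e_{σ j} − (n_{σ j}/n_{i₀}) e_{i₀})_j`, `σ = i₀.succAbove`. If `det(Λ B) ≠ 0` (i.e.
`ker Λ ∩ n^⊥ = 0`, the open condition (3.3) of the paper) then the `m` equations `Λ A y = 0` are
equivalent to the `m + 1` equations `A y = 0`. [cite: Sheshadri2026Border, §3.1 Step 3] -/
theorem mulVec_eq_zero_of_reduction {A : Matrix (Fin (m + 1)) (Fin (m + 1)) ℂ}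
    {n : Fin (m + 1) → ℂ} (hn : n ᵥ* A = 0) {i₀ : Fin (m + 1)} (hi₀ : n i₀ ≠ 0)
    (Λ : Matrix (Fin m) (Fin (m + 1)) ℂ)
    (hdet : (Λ * Matrix.of (fun i j => if i = i₀.succAbove j then (1 : ℂ)
      else if i = i₀ then -(n (i₀.succAbove j)) / n i₀ else 0)).det ≠ 0)
    (y : Fin (m + 1) → ℂ) (hy : Λ *ᵥ (A *ᵥ y) = 0) : A *ᵥ y = 0 := by
  set B : Matrix (Fin (m + 1)) (Fin m) ℂ := Matrix.of (fun i j => if i = i₀.succAbove j then (1 : ℂ)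
      else if i = i₀ then -(n (i₀.succAbove j)) / n i₀ else 0) with hB
  set w := A *ᵥ y with hw
  have hnw : n ⬝ᵥ w = 0 := by rw [hw, dotProduct_mulVec, hn, zero_dotProduct]
  -- `w = B z` with `z = w ∘ σ`
  set z : Fin m → ℂ := fun j => w (i₀.succAbove j) with hz
  have hBz : B *ᵥ z = w := by
    funext i
    simp only [mulVec, dotProduct, hB, Matrix.of_apply]
    by_cases hi : i = i₀
    · subst hi
      have hsum := Fin.sum_univ_succAbove (fun k => n k * w k) i
      change n ⬝ᵥ w = _ at hsum
      rw [hnw] at hsum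
      simp only [if_true]
      have : ∀ j : Fin m, (if i = i.succAbove j then (1 : ℂ) else -n (i.succAbove j) / n i) * z j =
          -(n i)⁻¹ * (n (i.succAbove j) * w (i.succAbove j)) := by
        intro j
        rw [if_neg (Fin.succAbove_ne i j).symm, hz]
        field_simp
      rw [Finset.sum_congr rfl fun j _ => this j, ← Finset.mul_sum]
      have h2 : ∑ j, n (i.succAbove j) * w (i.succAbove j) = -(n i * w i) := by
        linear_combination -hsum
      rw [h2]
      field_simp
    · obtain ⟨j', rfl⟩ := Fin.exists_succAbove_eq hi
      rw [Finset.sum_eq_single j']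
      · simp [hz]
      · intro j _ hjj'
        rw [if_neg (fun h => hjj' (Fin.succAbove_right_injective h).symm),
          if_neg (Fin.succAbove_ne i₀ j'), zero_mul]
      · intro h
        exact absurd (Finset.mem_univ j') h
  have hz0 : z = 0 := by
    have hinj : Function.Injective (Λ * B).mulVec :=
      Matrix.mulVec_injective_iff_isUnit.mpr
        ((Matrix.isUnit_iff_isUnit_det _).mpr (isUnit_iff_ne_zero.mpr hdet))
    apply hinj
    rw [mulVec_zero, ← mulVec_mulVec, hBz]
    exact hy
  rw [← hBz, hz0, mulVec_zero]

/-- **Genericity of the right reduction (arXiv:2606.13628, §3.1 Step 3, condition (3.3)).** For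
finitely many singular `(m+1) × (m+1)` matrices `A` (the homogenised pencil `Â(x*)` at the count
points, each of corank `≥ 1`) there is a non-zero polynomial `Ψ` in the entries of the reduction
matrix `Λ ∈ ℂ^{m × (m+1)}` such that `Ψ(Λ) ≠ 0` implies `ker Λ ∩ im A = 0` for all of them, i.e.
`Λ A y = 0 ⇔ A y = 0`: each condition excludes the proper closed subset `det(Λ B_A) = 0` of
`Λ`-space (non-empty complement: the coordinate projection killing `e_{i₀}`).
[cite: Sheshadri2026Border, §3.1 Step 3] -/
theorem exists_generic_reduction (S : Finset (Matrix (Fin (m + 1)) (Fin (m + 1)) ℂ))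
    (hS : ∀ A ∈ S, A.det = 0) :
    ∃ Ψ : MvPolynomial (Fin m × Fin (m + 1)) ℂ, Ψ ≠ 0 ∧
      ∀ Λ : Matrix (Fin m) (Fin (m + 1)) ℂ, eval (fun ij => Λ ij.1 ij.2) Ψ ≠ 0 →
        ∀ A ∈ S, ∀ y, Λ *ᵥ (A *ᵥ y) = 0 → A *ᵥ y = 0 := by
  classical
  -- one matrix at a time
  have key : ∀ A : Matrix (Fin (m + 1)) (Fin (m + 1)) ℂ, A.det = 0 →
      ∃ P : MvPolynomial (Fin m × Fin (m + 1)) ℂ, P ≠ 0 ∧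
        ∀ Λ : Matrix (Fin m) (Fin (m + 1)) ℂ, eval (fun ij => Λ ij.1 ij.2) P ≠ 0 →
          ∀ y, Λ *ᵥ (A *ᵥ y) = 0 → A *ᵥ y = 0 := by
    intro A hA
    obtain ⟨n, hn0, hn⟩ := Matrix.exists_vecMul_eq_zero_iff.mpr hA
    obtain ⟨i₀, hi₀⟩ := Function.ne_iff.mp hn0
    set B : Matrix (Fin (m + 1)) (Fin m) ℂ := Matrix.of (fun i j => if i = i₀.succAbove j then (1 : ℂ)
      else if i = i₀ then -(n (i₀.succAbove j)) / n i₀ else 0) with hB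
    set XΛ : Matrix (Fin m) (Fin (m + 1)) (MvPolynomial (Fin m × Fin (m + 1)) ℂ) :=
      Matrix.of fun i j => X (i, j) with hXΛ
    refine ⟨(XΛ * B.map C).det, ?_, fun Λ hΛ y hy => ?_⟩
    · -- non-vanishing at the coordinate projection `Λ₀`
      set Λ₀ : Matrix (Fin m) (Fin (m + 1)) ℂ := Matrix.of fun j i => if i = i₀.succAbove j then 1 else 0
        with hΛ₀
      intro h0
      have h1 := congrArg (eval (fun ij : Fin m × Fin (m + 1) => Λ₀ ij.1 ij.2)) h0
      rw [map_zero, RingHom.map_det, RingHom.mapMatrix_apply, Matrix.map_mul, Matrix.map_map] at h1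
      have hX : XΛ.map (eval fun ij : Fin m × Fin (m + 1) => Λ₀ ij.1 ij.2) = Λ₀ := by
        ext i j; simp [hXΛ]
      have hBB : B.map (⇑(eval fun ij : Fin m × Fin (m + 1) => Λ₀ ij.1 ij.2) ∘ ⇑C) = B := by
        ext i j; simp
      rw [hX, hBB] at h1
      have hone : Λ₀ * B = 1 := by
        ext j j'
        rw [Matrix.mul_apply, Finset.sum_eq_single (i₀.succAbove j)]
        · simp only [hΛ₀, hB, Matrix.of_apply, if_true, one_mul, Matrix.one_apply]
          by_cases hjj : j = j'
          · subst hjj; simp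
          · rw [if_neg (fun h => hjj (Fin.succAbove_right_injective h)),
              if_neg (Fin.succAbove_ne i₀ j), if_neg hjj]
        · intro i _ hi
          simp only [hΛ₀, Matrix.of_apply, if_neg hi, zero_mul]
        · intro h; exact absurd (Finset.mem_univ _) h
      rw [hone, Matrix.det_one] at h1
      exact one_ne_zero h1
    · refine mulVec_eq_zero_of_reduction hn hi₀ Λ ?_ y hy
      rw [RingHom.map_det, RingHom.mapMatrix_apply, Matrix.map_mul, Matrix.map_map] at hΛ
      have hX : XΛ.map (eval fun ij : Fin m × Fin (m + 1) => Λ ij.1 ij.2) = Λ := by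
        ext i j; simp [hXΛ]
      have hBB : B.map (⇑(eval fun ij : Fin m × Fin (m + 1) => Λ ij.1 ij.2) ∘ ⇑C) = B := by
        ext i j; simp
      rwa [hX, hBB] at hΛ
  choose! P hP0 hP using key
  refine ⟨∏ A ∈ S, P A, Finset.prod_ne_zero_iff.mpr fun A hA => hP0 A (hS A hA), fun Λ hΛ A hA y hy => ?_⟩
  rw [map_prod, Finset.prod_ne_zero_iff] at hΛ
  exact hP A (hS A hA) Λ (hΛ A hA) y hy

/-- **Genericity of the non-vanishing rows (arXiv:2606.13628, §3.1 Step 3, second condition).**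
For a non-zero matrix `Â` of polynomials (the homogenised pencil), a generic reduction matrix `Λ`
has no row `λ` with `λᵀ Â ≡ 0`: the left annihilators form a proper linear subspace.
Concretely there is a non-zero polynomial `Ψ` in the entries of `Λ` with `Ψ(Λ) ≠ 0 ⇒` every row
of `Λ Â` is a non-zero row of forms. [cite: Sheshadri2026Border, §3.1 Step 3] -/
theorem exists_generic_rows_ne_zero {τ : Type*}
    (Ahat : Matrix (Fin (m + 1)) (Fin (m + 1)) (MvPolynomial τ ℂ)) (hA : Ahat ≠ 0) :
    ∃ Ψ : MvPolynomial (Fin m × Fin (m + 1)) ℂ, Ψ ≠ 0 ∧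
      ∀ Λ : Matrix (Fin m) (Fin (m + 1)) ℂ, eval (fun ij => Λ ij.1 ij.2) Ψ ≠ 0 →
        ∀ j, (Λ.map (fun a : ℂ => (C a : MvPolynomial τ ℂ)) * Ahat) j ≠ 0 := by
  classical
  -- a non-zero coefficient of a non-zero entry
  obtain ⟨i₁, c₁, hic⟩ : ∃ i₁ c₁, Ahat i₁ c₁ ≠ 0 := by
    by_contra h
    push Not at h
    exact hA (Matrix.ext fun i j => h i j)
  obtain ⟨d, hd⟩ := MvPolynomial.ne_zero_iff.mp hic
  refine ⟨∏ j : Fin m, ∑ i : Fin (m + 1), C (coeff d (Ahat i c₁)) * X (j, i), ?_, fun Λ hΛ j hrow => ?_⟩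
  · refine Finset.prod_ne_zero_iff.mpr fun j _ => ?_
    intro h0
    have := congrArg (eval (fun ij : Fin m × Fin (m + 1) => if ij.2 = i₁ then (1 : ℂ) else 0)) h0
    simp only [map_sum, map_mul, eval_C, eval_X, map_zero, mul_ite, mul_one, mul_zero,
      Finset.sum_ite_eq', Finset.mem_univ, if_true] at this
    exact hd this
  · rw [map_prod, Finset.prod_ne_zero_iff] at hΛ
    have h1 := hΛ j (Finset.mem_univ j)
    simp only [map_sum, map_mul, eval_C, eval_X] at h1
    apply h1
    have h2 := congrArg (fun r : Fin (m + 1) → MvPolynomial τ ℂ => coeff d (r c₁)) hrow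
    simp only [Matrix.mul_apply, Matrix.map_apply, Pi.zero_apply, coeff_zero, coeff_sum,
      coeff_C_mul] at h2
    rw [← h2]
    exact Finset.sum_congr rfl fun i _ => mul_comm _ _

end DeterminantalConormal

end GenericReduction

/-! ### §3.1 Step 6: the generating-function definition of `B(m, N)`

The paper defines the two-kernel Bézout number as a coefficient,
`B(m, N) := [x^N u^{m−1} v^{m−1}] x (x+u)^m (x+v)^{m−1} (u+v)^{N−2}` — the Bézout number
`∫ H (H+U)^m (H+V)^{m−1} (U+V)^{N−2}` of the square system of Step 4 on
`ℙᴺ × ℙ^{m−1} × ℙ^{m−1}` — and Step 6 evaluates it to the closed form that the tree takes as the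
definition of `conormalBezout`. `coeff_generatingFunction_eq_conormalBezout` is that evaluation,
so the tree's `conormalBezout m N` is literally the paper's `B(m, N)` for `m ≥ 1`, `N ≥ 2`. -/

section GeneratingFunction

namespace DeterminantalConormal

/-- Binomial expansion of `(x_a + x_b)^n` into monomials. [folklore] -/
theorem X_add_X_pow_eq_sum (a b : Fin 3) (n : ℕ) :
    ((X a + X b) ^ n : MvPolynomial (Fin 3) ℕ) =
      ∑ k ∈ Finset.range (n + 1),
        monomial (Finsupp.single a k + Finsupp.single b (n - k)) (n.choose k) := by
  rw [add_pow]
  refine Finset.sum_congr rfl fun k _ => ?_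
  rw [X_pow_eq_monomial, X_pow_eq_monomial, monomial_mul, ← C_eq_coe_nat, mul_comm, C_mul_monomial,
    mul_one, mul_one, Nat.cast_id]

/-- Equality of exponent vectors on `Fin 3` is equality of the three exponents. [folklore] -/
theorem finsupp_fin_three_eq_iff (e d : Fin 3 →₀ ℕ) :
    e = d ↔ e 0 = d 0 ∧ e 1 = d 1 ∧ e 2 = d 2 := by
  constructor
  · rintro rfl
    exact ⟨rfl, rfl, rfl⟩
  · rintro ⟨h0, h1, h2⟩
    ext i
    fin_cases i
    · exact h0
    · exact h1
    · exact h2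

/-- **The generating-function definition of the two-kernel Bézout number (arXiv:2606.13628,
Thm. 3 (i) and §3.1 Step 6).** The paper DEFINES
`B(m, N) := [x^N u^{m−1} v^{m−1}] x (x+u)^m (x+v)^{m−1} (u+v)^{N−2}` (the Bézout number of the
square system of §3.1 Step 4 on `ℙᴺ × ℙ^{m−1} × ℙ^{m−1}`: classes `H`, `(H+U)^m`, `(H+V)^{m−1}`,
`(U+V)^{N−2}`) and evaluates it in Step 6 to the closed form
`Σ_{i=1}^{N−1} C(m,i) C(m−1,N−1−i) C(N−2,i−1)`, which is the tree's `conormalBezout m N`. This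
theorem is that evaluation: with `x = X 0`, `u = X 1`, `v = X 2`, the coefficient of
`x^N u^{m−1} v^{m−1}` in the product is `conormalBezout m N` (for `N ≥ 2`, `m ≥ 1`, where the
exponents `m − 1`, `N − 2` of the paper are meaningful). [cite: Sheshadri2026Border, §3.1 Step 6] -/
theorem coeff_generatingFunction_eq_conormalBezout (m N : ℕ) (hm : 1 ≤ m) (hN : 2 ≤ N) :
    coeff (Finsupp.single 0 N + Finsupp.single 1 (m - 1) + Finsupp.single 2 (m - 1))
      ((X 0 * (X 0 + X 1) ^ m * (X 0 + X 2) ^ (m - 1) * (X 1 + X 2) ^ (N - 2) :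
        MvPolynomial (Fin 3) ℕ)) = conormalBezout m N := by
  -- expand into a triple sum of monomials and extract the coefficient
  rw [X_add_X_pow_eq_sum 0 1 m, X_add_X_pow_eq_sum 0 2 (m - 1), X_add_X_pow_eq_sum 1 2 (N - 2)]
  rw [show (X 0 : MvPolynomial (Fin 3) ℕ) = monomial (Finsupp.single 0 1) 1 from rfl]
  simp only [Finset.mul_sum, Finset.sum_mul, monomial_mul, coeff_sum, coeff_monomial]
  -- the exponent test, coordinatewise
  have htest : ∀ i j k : ℕ,
      (Finsupp.single (0 : Fin 3) 1 + (Finsupp.single 0 i + Finsupp.single 1 (m - i)) +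
        (Finsupp.single 0 j + Finsupp.single 2 (m - 1 - j)) +
        (Finsupp.single 1 k + Finsupp.single 2 (N - 2 - k)) =
        Finsupp.single 0 N + Finsupp.single 1 (m - 1) + Finsupp.single 2 (m - 1)) ↔
      (1 + i + j = N ∧ m - i + k = m - 1 ∧ m - 1 - j + (N - 2 - k) = m - 1) := by
    intro i j k
    rw [finsupp_fin_three_eq_iff]
    have e0 : ∀ a b c : ℕ, ((Finsupp.single (0 : Fin 3) a + Finsupp.single 1 b +
        Finsupp.single 2 c : Fin 3 →₀ ℕ) : Fin 3 → ℕ) 0 = a := fun a b c => by simp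
    have e1 : ∀ a b c : ℕ, ((Finsupp.single (0 : Fin 3) a + Finsupp.single 1 b +
        Finsupp.single 2 c : Fin 3 →₀ ℕ) : Fin 3 → ℕ) 1 = b := fun a b c => by simp
    have e2 : ∀ a b c : ℕ, ((Finsupp.single (0 : Fin 3) a + Finsupp.single 1 b +
        Finsupp.single 2 c : Fin 3 →₀ ℕ) : Fin 3 → ℕ) 2 = c := fun a b c => by simp
    have f0 : ((Finsupp.single (0 : Fin 3) 1 + (Finsupp.single 0 i + Finsupp.single 1 (m - i)) +
        (Finsupp.single 0 j + Finsupp.single 2 (m - 1 - j)) +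
        (Finsupp.single 1 k + Finsupp.single 2 (N - 2 - k)) : Fin 3 →₀ ℕ) : Fin 3 → ℕ) 0 =
        1 + i + j := by simp
    have f1 : ((Finsupp.single (0 : Fin 3) 1 + (Finsupp.single 0 i + Finsupp.single 1 (m - i)) +
        (Finsupp.single 0 j + Finsupp.single 2 (m - 1 - j)) +
        (Finsupp.single 1 k + Finsupp.single 2 (N - 2 - k)) : Fin 3 →₀ ℕ) : Fin 3 → ℕ) 1 =
        m - i + k := by simp
    have f2 : ((Finsupp.single (0 : Fin 3) 1 + (Finsupp.single 0 i + Finsupp.single 1 (m - i)) +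
        (Finsupp.single 0 j + Finsupp.single 2 (m - 1 - j)) +
        (Finsupp.single 1 k + Finsupp.single 2 (N - 2 - k)) : Fin 3 →₀ ℕ) : Fin 3 → ℕ) 2 =
        m - 1 - j + (N - 2 - k) := by
      simp
    rw [f0, f1, f2, e0, e1, e2]
  simp_rw [htest]
  -- collapse the two inner sums for each `k`: `i = k + 1`, `j = N − 2 − k`
  have hinner : ∀ k ∈ Finset.range (N - 2 + 1),
      (∑ j ∈ Finset.range (m - 1 + 1), ∑ i ∈ Finset.range (m + 1),
        if 1 + i + j = N ∧ m - i + k = m - 1 ∧ m - 1 - j + (N - 2 - k) = m - 1 then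
          1 * (m.choose i) * ((m - 1).choose j) * ((N - 2).choose k) else 0) =
      m.choose (k + 1) * (m - 1).choose (N - 2 - k) * (N - 2).choose k := by
    intro k hk
    rw [Finset.mem_range] at hk
    by_cases hkm : k + 1 ≤ m
    · by_cases hkN : N - 2 - k ≤ m - 1
      · rw [Finset.sum_eq_single (N - 2 - k)]
        · rw [Finset.sum_eq_single (k + 1)]
          · rw [if_pos ⟨by omega, by omega, by omega⟩, one_mul]
          · intro i _ hi
            rw [if_neg (by omega)]
          · intro hi
            rw [Finset.mem_range] at hi
            omega
        · intro j _ hj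
          exact Finset.sum_eq_zero fun i hi => if_neg (by
            rw [Finset.mem_range] at hi
            omega)
        · intro hj
          rw [Finset.mem_range] at hj
          omega
      · -- `N − 2 − k > m − 1`: no `j` in range, and the binomial coefficient vanishes
        rw [Nat.choose_eq_zero_of_lt (n := m - 1) (by omega), mul_zero, zero_mul]
        refine Finset.sum_eq_zero fun j hj => Finset.sum_eq_zero fun i hi => if_neg ?_
        rw [Finset.mem_range] at hj hi
        omega
    · -- `k + 1 > m`: no `i` in range, and the binomial coefficient vanishes
      rw [Nat.choose_eq_zero_of_lt (n := m) (by omega), zero_mul, zero_mul]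
      refine Finset.sum_eq_zero fun j hj => Finset.sum_eq_zero fun i hi => if_neg ?_
      rw [Finset.mem_range] at hj hi
      omega
  rw [Finset.sum_congr rfl hinner, conormalBezout_eq_sum_range,
    show N - 2 + 1 = N - 1 by omega]

end DeterminantalConormal

end GeneratingFunction

end Literature.Computability.AlgebraicComplexity
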